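import Summits.HodgeConjecture.CorCM.GaloisIndexTwoTwoCyclic
import Summits.HodgeConjecture.CorCM.CyclicTimesFourSubgroupLemmas
import Summits.HodgeConjecture.CorCM.GaloisTwoPowerOrderFourClassification
import Mathlib.GroupTheory.GroupAction.ConjAct
import Mathlib.GroupTheory.IndexNormal
import HarnessLib

/-!
# An abelian subgroup `⟨a⟩ × ⟨y⟩ ≅ C_{2^m} × C₄` of index two containing complex conjugation `c ≠ y²` makes the field BAD

COR-CM (cell `pub-hodgecm2`), binder seat b04 (gen 34), count-neutral own lane «Galois-CM-type classification».  KERNEL ONLY: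
theorems; no definition, no named fact, no `sorry`.  `HC_CM` is neither used nor claimed.  A packaged instance of gen 30's
two-cyclic criterion (`SplitInvolution.exists_simple_degenerate_of_two_cyclic`) needing NO information on how the odd coset acts:
commuting `a` (order `2^m`, `m ≥ 3`) and `y` (order `4`) in `Gal(K/ℚ)` with `⟨a⟩ ∩ ⟨y⟩ = 1`, `A = ⟨a, y⟩` of index `2`, `c ∈ A`,
`c ≠ y²` ⟹ BAD.  (`c ∈ {α, αt}`, `α = a^(2^(m-1))`, `t = y²`; the independent `c`-avoiding cyclic subgroups are `⟨y⟩` and `⟨a²⟩` if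
`c = αt`, resp. `⟨a^(±2^(m-2)) y⟩` if `c = α`, the sign chosen so that `x y x⁻¹` — whose square `x t x⁻¹` is not `α` — avoids it; group
lemmas in `CorCM/CyclicTimesFourSubgroupLemmas`.)  TERMINAL KILL for the remaining piece (R2) of the `2`-power classification
(A7-JUNCTION gen-34 §D, «an element `y` of order `4` with `y² = t ≠ c`»): rows `C₄ ⋊ C_{2^a}` (`A = ⟨g², y⟩`), `Q_{2^k} × C₄`,
`C_{2^k} × C₄`, and the configurations `⟨a⟩ × ⟨y⟩` reached by the descent `G → G/⟨t⟩`.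

* `exists_simple_degenerate_of_cyclic_times_four_index_two` — the theorem; `isNondegenerate_false_of_cyclic_times_four_index_two` —
  GOOD contrapositive (such `a, y` do not exist in a GOOD field).

## References

* [Shimura1998] G. Shimura, *Abelian Varieties with Complex Multiplication and Modular Functions*, §6.2 Thm. 3, §8.2 Prop. 26.
* [Kubota1965] T. Kubota, *On the field extension by complex multiplication*, Trans. AMS 118 (1965), §2 and §4 Lemma 2.
* [Gordon1999HodgeAVSurvey] B. B. Gordon, *A survey of the Hodge conjecture for abelian varieties*, Thm. 6.4, §9.3.
-/

noncomputable section

open CategoryTheory CategoryTheory.Limits NumberField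
open scoped BigOperators

namespace Summit.HodgeConjecture.CorCM.GaloisModels

open Literature.NumberTheory.ComplexMultiplication
open Literature.AlgebraicGeometry.Motives (AbelianVariety CMType)
open Literature.AlgebraicGeometry.HodgeTheory
open Literature.AlgebraicGeometry.ComplexMultiplication (IsCMTypeRealisation)
open Literature.AlgebraicGeometry.Pohlmann1968
open Literature.Barriers.HodgeConjecture (divisorClassesSpan)
open Summit.HodgeConjecture.CorCM.GaloisRank

variable {K : Type} [Field K] [NumberField K] [IsCMField K] [IsGalois ℚ K]

/-- **`⟨a⟩ × ⟨y⟩ ≅ C_{2^m} × C₄` OF INDEX TWO CONTAINING `c ≠ y²` ⟹ BAD.**  `K` Galois CM; `a, y ∈ Gal(K/ℚ)` commute, `orderOf a = 2^m`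
(`m ≥ 3`), `y⁴ = 1 ≠ y²`, `⟨a⟩ ∩ ⟨y⟩ = 1`, the subgroup `A` generated by `a, y` has index `2`, and complex conjugation lies in `A`
and differs from `y²`.  Then `K` carries a SIMPLE DEGENERATE abelian variety of dimension `[K:ℚ]/2` with a rational `(p,p)` class
outside the divisor ring on some power. [cite: Kubota1965, §2 and §4 Lemma 2] [cite: Shimura1998, §6.2 Thm. 3 and §8.2 Prop. 26]
[cite: Gordon1999HodgeAVSurvey, Thm. 6.4 and §9.3] -/
theorem exists_simple_degenerate_of_cyclic_times_four_index_two (a y : K ≃ₐ[ℚ] K) (hay : a * y = y * a) {m : ℕ}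
    (hm : 3 ≤ m) (ha : orderOf a = 2 ^ m) (hy4 : y ^ 4 = 1) (hy2 : y * y ≠ 1)
    (hint : ∀ g : K ≃ₐ[ℚ] K, g ∈ Subgroup.zpowers a → g ∈ Subgroup.zpowers y → g = 1)
    (hidx : (Subgroup.closure ({a, y} : Set (K ≃ₐ[ℚ] K))).index = 2)
    (hcA : (IsCMField.complexConj K).restrictScalars ℚ ∈ Subgroup.closure ({a, y} : Set (K ≃ₐ[ℚ] K)))
    (hct : (IsCMField.complexConj K).restrictScalars ℚ ≠ y * y) :
    ∃ (Φ : CMType K) (φ : K →+* ℂ) (X : AbelianVariety ℂ) (ι : 𝓞 K →+* End X)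
      (ϑ : K →+* Module.End ℂ (complexBetti X.X 1)),
      IsPrimitive (ℂ ≃+* ℂ) Φ.1 φ ∧ ¬ IsNondegenerate Φ ∧ IsCMTypeRealisation Φ X ι ϑ ∧ X.IsSimple ∧
      X.dim = Fintype.card (K ≃ₐ[ℚ] K) / 2 ∧
      ∃ n p : ℕ, ∃ z : complexBetti (⨁ fun _ : Fin n => X).X (2 * p), IsRationalClass z ∧
        IsOfHodgeType (⨁ fun _ : Fin n => X).dim (⨁ fun _ : Fin n => X).X (2 * p) p p z ∧
        z ∉ divisorClassesSpan (⨁ fun _ : Fin n => X).X (⨁ fun _ : Fin n => X).dim p := by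
  classical
  set c := (IsCMField.complexConj K).restrictScalars ℚ with hc
  have hcc : c * c = 1 := model_complexConj_mul_self (MulEquiv.refl (K ≃ₐ[ℚ] K)) (by simp [hc])
  have hc1 : c ≠ 1 := model_complexConj_ne_one (MulEquiv.refl (K ≃ₐ[ℚ] K)) (by simp [hc])
  set A := Subgroup.closure ({a, y} : Set (K ≃ₐ[ℚ] K)) with hAdef
  haveI hAn : A.Normal := Subgroup.normal_of_index_eq_two hidx
  have hcomm : Commute a y := hay
  have haA : a ∈ A := Subgroup.subset_closure (by simp)
  have hyA : y ∈ A := Subgroup.subset_closure (by simp)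
  have h2m : ((2 : ℤ) ^ m) = 2 * 2 ^ (m - 1) := by rw [← pow_succ', Nat.sub_add_cancel (by omega)]
  have h4m : ((2 : ℤ) ^ (m - 1)) = 2 * 2 ^ (m - 2) := by rw [← pow_succ', show m - 2 + 1 = m - 1 by omega]
  have ha2m : a ^ ((2 : ℤ) ^ m) = 1 := by
    rw [show ((2 : ℤ) ^ m) = ((2 ^ m : ℕ) : ℤ) by push_cast; rfl, zpow_natCast, ← ha, pow_orderOf_eq_one]
  set α := a ^ ((2 : ℤ) ^ (m - 1)) with hα
  set t := y * y with ht
  have hy2z : y ^ (2 : ℤ) = t := zpow_two y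
  have hy4z : y ^ (4 : ℤ) = 1 := by rw [show (4 : ℤ) = ((4 : ℕ) : ℤ) by norm_num, zpow_natCast, hy4]
  have htt : t * t = 1 := by rw [← hy2z, ← zpow_add, show (2 : ℤ) + 2 = 4 by norm_num, hy4z]
  have ht1 : t ≠ 1 := hy2
  have hinvol : ∀ s : K ≃ₐ[ℚ] K, s * s = 1 → ∀ i : ℤ, s ^ i = 1 ∨ s ^ i = s := fun s hss i =>
    zpow_eq_one_or_eq_of_mul_self_eq_one hss i
  have hαα : α * α = 1 := by rw [hα, ← zpow_add, ← two_mul, ← h2m, ha2m]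
  have hα1 : α ≠ 1 := by
    rw [hα, show ((2 : ℤ) ^ (m - 1)) = ((2 ^ (m - 1) : ℕ) : ℤ) by push_cast; rfl, zpow_natCast]
    exact pow_ne_one_of_lt_orderOf (by positivity) (by rw [ha]; exact Nat.pow_lt_pow_right (by norm_num) (by omega))
  have hαZa : ∀ i : ℤ, α ^ i ∈ Subgroup.zpowers a := fun i => by
    rw [hα, ← zpow_mul]; exact Subgroup.zpow_mem _ (Subgroup.mem_zpowers a) _
  have hαmem : α ∈ Subgroup.zpowers a := by have := hαZa 1; rwa [zpow_one] at this
  have htZy : t ∈ Subgroup.zpowers y := by rw [← hy2z]; exact Subgroup.zpow_mem _ (Subgroup.mem_zpowers y) _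
  have hsplit : ∀ (i j : ℤ), a ^ i * y ^ j = 1 → a ^ i = 1 ∧ y ^ j = 1 := CyclicTimesFour.one_of_zpow_mul_zpow_eq_one hint
  have hZa2 : ∀ i : ℤ, a ^ (2 * i) = 1 → a ^ i = 1 ∨ a ^ i = α :=
    CyclicTimesFour.zpow_eq_one_or_eq_halfpower (by omega) ha
  have hZy2 : ∀ j : ℤ, y ^ (2 * j) = 1 → y ^ j = 1 ∨ y ^ j = t := CyclicTimesFour.zpow_eq_one_or_eq_sq hy4 hy2
  have hform : ∀ u ∈ A, ∃ i j : ℤ, u = a ^ i * y ^ j := fun u hu => CyclicTimesFour.exists_eq_zpow_mul_zpow hay hu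
  have hcommA : ∀ u ∈ A, ∀ v ∈ A, u * v = v * u := fun u hu v hv => CyclicTimesFour.mul_comm_of_mem_closure hay hu hv
  letI : CommGroup A := { (inferInstance : Group A) with mul_comm := fun u v => Subtype.ext (hcommA u u.2 v v.2) }
  have hordy : orderOf y = 4 := by
    have := orderOf_eq_prime_pow (p := 2) (n := 1) (x := y) (by rw [pow_one, pow_two]; exact hy2)
      (by rw [show 2 ^ (1 + 1) = 4 by norm_num, hy4])
    simpa using this
  have hAcard : 2 ^ m * 4 ≤ Fintype.card A := by
    rw [← Nat.card_eq_fintype_card, ← ha, ← hordy]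
    exact CyclicTimesFour.mul_card_le_card_closure hint
  have h32 : 32 ≤ Fintype.card A := le_trans (by
    calc (32 : ℕ) = 2 ^ 3 * 4 := by norm_num
      _ ≤ 2 ^ m * 4 := Nat.mul_le_mul_right 4 (Nat.pow_le_pow_right (by norm_num) hm)) hAcard
  have hcαt : c = α ∨ c = α * t := CyclicTimesFour.involution_eq_halfpower_or hay (by omega) ha hy4 hy2 hint hcA hcc hc1 hct
  obtain ⟨x, hxA⟩ : ∃ x : K ≃ₐ[ℚ] K, x ∉ A := by
    by_contra h
    push Not at h
    have htop : A = ⊤ := (Subgroup.eq_top_iff' A).2 h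
    rw [htop, Subgroup.index_top] at hidx
    norm_num at hidx
  have hcov : ∀ g : K ≃ₐ[ℚ] K, (∃ u : A, g = A.subtype u) ∨ (∃ u : A, g = A.subtype u * x) := by
    intro g
    by_cases hg : g ∈ A
    · exact Or.inl ⟨⟨g, hg⟩, rfl⟩
    · right
      have hgx : g * x⁻¹ ∈ A := by
        rw [Subgroup.mul_mem_iff_of_index_two hidx, Subgroup.inv_mem_iff]
        exact ⟨fun h => absurd h hg, fun h => absurd h hxA⟩
      exact ⟨⟨g * x⁻¹, hgx⟩, by rw [Subgroup.coe_subtype, inv_mul_cancel_right]⟩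
  let θ : A ≃* A := MulAut.conjNormal x
  have hθ : ∀ u : A, x * A.subtype u = A.subtype (θ u) * x := fun u => by
    show x * (u : K ≃ₐ[ℚ] K) = (MulAut.conjNormal x u : K ≃ₐ[ℚ] K) * x
    rw [MulAut.conjNormal_apply, inv_mul_cancel_right]
  have hxq : x * x ∈ A := Subgroup.mul_self_mem_of_index_two hidx x
  have hxα : x * α * x⁻¹ = α := CyclicTimesFour.conj_halfpower_eq hay hm ha hy4 x
  have hxt : x * t * x⁻¹ ≠ α := CyclicTimesFour.conj_sq_ne_halfpower hay hm ha hy4 hy2 hint x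
  let u₀ : A := ⟨y, hyA⟩
  let c' : A := ⟨c, hcA⟩
  let q : A := ⟨x * x, hxq⟩
  have hu₀1 : u₀ ≠ 1 := fun h => hy2 (by
    have := congrArg Subtype.val h
    simp only [Subgroup.coe_one] at this
    change y = 1 at this
    show y * y = 1
    rw [this, mul_one])
  have hord₀ : orderOf u₀ = 4 := by rw [← hordy]; exact Subgroup.orderOf_mk y hyA
  have hcu₀ : c' ∉ Subgroup.zpowers u₀ := by
    intro h
    obtain ⟨j, hj⟩ := Subgroup.mem_zpowers_iff.1 h
    have hj' : y ^ j = c := by have := congrArg Subtype.val hj; simpa using this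
    have hyj : y ^ (2 * j) = 1 := by rw [mul_comm, zpow_mul, hj', zpow_two, hcc]
    rcases hZy2 j hyj with h | h
    · exact hc1 (hj'.symm.trans h)
    · exact hct (hj'.symm.trans h)
  have hclos : ∀ v : A, v ∈ Subgroup.closure ({u₀, c'} : Set A) → ∃ i k : ℤ, (v : K ≃ₐ[ℚ] K) = y ^ i * c ^ k := by
    intro v hv
    obtain ⟨i, k, hik⟩ := Subgroup.mem_closure_pair.1 hv
    exact ⟨i, k, by have := congrArg Subtype.val hik; simpa using this.symm⟩
  have hzp : ∀ (v w : A), w ∈ Subgroup.zpowers v → ∃ j : ℤ, (w : K ≃ₐ[ℚ] K) = (v : K ≃ₐ[ℚ] K) ^ j := by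
    intro v w hw
    obtain ⟨j, hj⟩ := Subgroup.mem_zpowers_iff.1 hw
    exact ⟨j, by have := congrArg Subtype.val hj; simpa using this.symm⟩
  have hcpow : ∀ k : ℤ, c ^ k = 1 ∨ c ^ k = c := hinvol c hcc
  have hθu₀ : ((θ u₀ : A) : K ≃ₐ[ℚ] K) = x * y * x⁻¹ := MulAut.conjNormal_apply x u₀
  have hxysq : (x * y * x⁻¹) ^ (2 : ℤ) = x * t * x⁻¹ := by rw [zpow_two, ht]; group
  set P : ℤ := (2 : ℤ) ^ (m - 2) with hP
  have hPα : a ^ (P * 2) = α := by rw [hα, h4m, hP, mul_comm]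
  have hP4 : a ^ (P * 4) = 1 := by rw [show P * 4 = (2 : ℤ) ^ m by rw [h2m, h4m, hP]; ring, ha2m]
  suffices hU : ∃ u₁ : A, c' ∉ Subgroup.zpowers u₁ ∧ u₁ ∉ Subgroup.closure ({u₀, c'} : Set A) ∧
      (∀ w : A, w ∈ Subgroup.zpowers u₀ → w ∈ Subgroup.zpowers u₁ → w = 1) ∧ θ u₀ ∉ Subgroup.zpowers u₁ ∧
      4 * orderOf u₁ < Fintype.card A by
    obtain ⟨u₁, hcu₁, hind, hint', hθU, hQ₁⟩ := hU
    exact SplitInvolution.exists_simple_degenerate_of_two_cyclic (MulEquiv.refl (K ≃ₐ[ℚ] K)) A.subtype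
      Subtype.coe_injective x (fun u h => hxA (h ▸ u.2)) hcov θ hθ q rfl c' rfl u₀ u₁ hcu₀ hcu₁ hu₀1 hind hint' hθU
      (by rw [hord₀]; omega) hQ₁
  rcases hcαt with hcα | hcαt'
  · -- CASE `c = α`: `u₁ = a^(εP) y` with `ε = ±1` chosen so that `x y x⁻¹ ∉ ⟨u₁⟩`
    have hgen : ∀ ε : ℤ, (ε = 1 ∨ ε = -1) → x * y * x⁻¹ ∉ Subgroup.zpowers (a ^ (ε * P) * y) →
        ∃ u₁ : A, c' ∉ Subgroup.zpowers u₁ ∧ u₁ ∉ Subgroup.closure ({u₀, c'} : Set A) ∧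
        (∀ w : A, w ∈ Subgroup.zpowers u₀ → w ∈ Subgroup.zpowers u₁ → w = 1) ∧ θ u₀ ∉ Subgroup.zpowers u₁ ∧
        4 * orderOf u₁ < Fintype.card A := by
      intro ε hε hnot
      set g := a ^ (ε * P) with hg
      have hgy : Commute g y := hcomm.zpow_left _
      have hgZa : ∀ j : ℤ, g ^ j ∈ Subgroup.zpowers a := fun j => by
        rw [hg, ← zpow_mul]; exact Subgroup.zpow_mem _ (Subgroup.mem_zpowers a) _
      have hg2 : g ^ (2 : ℤ) = α := by
        rcases hε with rfl | rfl
        · rw [hg, one_mul, ← zpow_mul, hPα]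
        · rw [hg, ← zpow_mul, show (-1 : ℤ) * P * 2 = -(P * 2) by ring, zpow_neg, hPα]
          exact inv_eq_of_mul_eq_one_right hαα
      have hg4 : g ^ (4 : ℤ) = 1 := by rw [show (4 : ℤ) = 2 * 2 by norm_num, zpow_mul, hg2, zpow_two, hαα]
      have hg1 : ∀ j : ℤ, g ^ j = 1 → (4 : ℤ) ∣ j := by
        intro j hj
        have hd : (orderOf a : ℤ) ∣ ε * P * j := orderOf_dvd_iff_zpow_eq_one.2 (by rw [zpow_mul]; exact hj)
        rw [ha] at hd
        push_cast at hd
        rw [h2m, h4m, show (2 : ℤ) * (2 * P) = P * 4 by ring, show ε * P * j = P * (ε * j) by ring] at hd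
        have h' : (4 : ℤ) ∣ ε * j := (mul_dvd_mul_iff_left (by positivity)).1 hd
        rcases hε with rfl | rfl
        · simpa using h'
        · rw [neg_one_mul, dvd_neg] at h'; exact h'
      have hgyA : g * y ∈ A := A.mul_mem (A.zpow_mem haA _) hyA
      let u₁ : A := ⟨g * y, hgyA⟩
      refine ⟨u₁, ?_, ?_, ?_, ?_, ?_⟩
      · -- `c ∉ ⟨g y⟩`
        intro h
        obtain ⟨j, hj⟩ := hzp u₁ c' h
        change c = (g * y) ^ j at hj
        rw [hgy.mul_zpow] at hj
        have hy1 : y ^ j = 1 := hint _ (by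
          rw [show y ^ j = (g ^ j)⁻¹ * c by rw [hj, inv_mul_cancel_left], hcα]
          exact Subgroup.mul_mem _ (Subgroup.inv_mem _ (hgZa j)) hαmem)
          (Subgroup.zpow_mem _ (Subgroup.mem_zpowers y) j)
        obtain ⟨r, hr⟩ : (4 : ℤ) ∣ j := by
          have hd : (orderOf y : ℤ) ∣ j := orderOf_dvd_iff_zpow_eq_one.2 hy1
          rwa [hordy] at hd
        rw [hy1, mul_one, hr, zpow_mul, hg4, one_zpow] at hj
        exact hc1 hj
      · -- `g y ∉ ⟨y, c⟩`
        intro h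
        obtain ⟨i, k, hik⟩ := hclos u₁ h
        change g * y = y ^ i * c ^ k at hik
        have hgeq : g * (c ^ k)⁻¹ = y ^ (i - 1) := by
          rw [mul_inv_eq_iff_eq_mul, zpow_sub, zpow_one,
            show y ^ i * y⁻¹ * c ^ k = y ^ i * c ^ k * y⁻¹ by
              rw [hcα, mul_assoc, mul_assoc, ((hcomm.zpow_left _).symm.inv_left.zpow_right k).eq],
            ← hik, mul_inv_cancel_right]
        have hgc : g * (c ^ k)⁻¹ = 1 := hint _
          (Subgroup.mul_mem _ (by simpa using hgZa 1) (Subgroup.inv_mem _ (hcα ▸ hαZa k)))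
          (hgeq ▸ Subgroup.zpow_mem _ (Subgroup.mem_zpowers y) _)
        rw [mul_inv_eq_one] at hgc
        rcases hcpow k with hk | hk <;> rw [hk] at hgc
        · exact hα1 (by rw [← hg2, hgc, one_zpow])
        · exact hα1 (by rw [← hg2, hgc, zpow_two, hcc])
      · -- `⟨y⟩ ∩ ⟨g y⟩ = 1`
        intro w hw₀ hw₁
        obtain ⟨i, hi⟩ := hzp u₀ w hw₀
        obtain ⟨j, hj⟩ := hzp u₁ w hw₁
        change (w : K ≃ₐ[ℚ] K) = y ^ i at hi
        change (w : K ≃ₐ[ℚ] K) = (g * y) ^ j at hj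
        rw [hgy.mul_zpow] at hj
        have hgj : g ^ j = y ^ (i - j) := by rw [zpow_sub, ← hi, hj, mul_inv_cancel_right]
        have hgj1 : g ^ j = 1 := hint _ (hgZa j) (hgj ▸ Subgroup.zpow_mem _ (Subgroup.mem_zpowers y) _)
        obtain ⟨r, hr⟩ := hg1 j hgj1
        apply Subtype.ext
        show (w : K ≃ₐ[ℚ] K) = 1
        rw [hj, hgj1, one_mul, hr, zpow_mul, hy4z, one_zpow]
      · -- `x y x⁻¹ ∉ ⟨g y⟩`
        intro h
        apply hnot
        obtain ⟨j, hj⟩ := hzp u₁ (θ u₀) h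
        rw [hθu₀] at hj
        rw [hj]
        exact Subgroup.zpow_mem _ (Subgroup.mem_zpowers _) j
      · -- `4 · ord(g y) ≤ 16 < 32 ≤ |A|`
        have : orderOf u₁ ≤ 4 := by
          refine orderOf_le_of_pow_eq_one (by norm_num) (Subtype.ext ?_)
          show (g * y) ^ 4 = 1
          rw [hgy.mul_pow, hy4, mul_one, ← zpow_natCast, show ((4 : ℕ) : ℤ) = 4 by norm_num, hg4]
        omega
    by_cases h1 : x * y * x⁻¹ ∈ Subgroup.zpowers (a ^ ((1 : ℤ) * P) * y)
    · refine hgen (-1) (Or.inr rfl) fun h2 => ?_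
      obtain ⟨j, hj⟩ := Subgroup.mem_zpowers_iff.1 h1
      obtain ⟨k, hk⟩ := Subgroup.mem_zpowers_iff.1 h2
      set g := a ^ ((1 : ℤ) * P) with hg
      have hg' : a ^ ((-1 : ℤ) * P) = g⁻¹ := by rw [hg, ← zpow_neg, neg_mul]
      rw [hg'] at hk
      have hgy : Commute g y := hcomm.zpow_left _
      have hgy' : Commute g⁻¹ y := hgy.inv_left
      have hg4 : g ^ (4 : ℤ) = 1 := by rw [hg, one_mul, ← zpow_mul, hP4]
      have hjodd : Odd j := by
        by_contra hev
        rw [Int.not_odd_iff_even] at hev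
        obtain ⟨r, hr⟩ := hev
        have hsq : (x * y * x⁻¹) ^ (2 : ℤ) = 1 := by
          rw [← hj, ← zpow_mul, hr, show (r + r) * (2 : ℤ) = 4 * r by ring, zpow_mul, hgy.mul_zpow, hg4, hy4z,
            one_mul, one_zpow]
        rw [hxysq] at hsq
        exact ht1 (by have := congrArg (fun w => x⁻¹ * w * x) hsq; simpa [mul_assoc] using this)
      have e1 : g ^ j * y ^ j = g ^ (-k) * y ^ k := by rw [← hgy.mul_zpow, hj, ← hk, hgy'.mul_zpow, inv_zpow']
      have e2 : g ^ (k + j) * y ^ (j - k) = 1 := by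
        calc g ^ (k + j) * y ^ (j - k) = g ^ k * (g ^ j * y ^ j) * (y ^ k)⁻¹ := by rw [zpow_add, zpow_sub]; group
          _ = g ^ k * (g ^ (-k) * y ^ k) * (y ^ k)⁻¹ := by rw [e1]
          _ = 1 := by rw [zpow_neg]; group
      have e3 := hsplit ((1 : ℤ) * P * (k + j)) (j - k) (by rw [zpow_mul, ← hg]; exact e2)
      have hd1 : (4 : ℤ) ∣ j - k := by
        have hd : (orderOf y : ℤ) ∣ j - k := orderOf_dvd_iff_zpow_eq_one.2 e3.2
        rwa [hordy] at hd
      have hd2 : (4 : ℤ) ∣ k + j := by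
        have hd : (orderOf a : ℤ) ∣ 1 * P * (k + j) := orderOf_dvd_iff_zpow_eq_one.2 e3.1
        rw [ha] at hd
        push_cast at hd
        rw [h2m, h4m, show (2 : ℤ) * (2 * P) = P * 4 by ring, show (1 : ℤ) * P * (k + j) = P * (k + j) by ring] at hd
        exact (mul_dvd_mul_iff_left (by positivity)).1 hd
      obtain ⟨r, hr⟩ := hjodd
      omega
    · exact hgen 1 (Or.inl rfl) h1
  · -- CASE `c = α t`: `u₁ = a²`
    have ha2A : a ^ (2 : ℤ) ∈ A := A.zpow_mem haA 2
    let u₁ : A := ⟨a ^ (2 : ℤ), ha2A⟩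
    have hαt : Commute α t := by rw [hα, ← hy2z]; exact (hcomm.zpow_left _).zpow_right _
    refine ⟨u₁, ?_, ?_, ?_, ?_, ?_⟩
    · -- `c ∉ ⟨a²⟩`: else `t ∈ ⟨a⟩`
      intro h
      obtain ⟨j, hj⟩ := hzp u₁ c' h
      change c = (a ^ (2 : ℤ)) ^ j at hj
      apply ht1
      refine hint t ?_ htZy
      rw [show t = α⁻¹ * c by rw [hcαt', inv_mul_cancel_left], hj, hα, ← zpow_neg, ← zpow_mul, ← zpow_add]
      exact Subgroup.zpow_mem _ (Subgroup.mem_zpowers a) _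
    · -- `a² ∉ ⟨y, c⟩`
      intro h
      obtain ⟨i, k, hik⟩ := hclos u₁ h
      change a ^ (2 : ℤ) = y ^ i * c ^ k at hik
      have hord4 : ¬ orderOf a ∣ 4 := by
        rw [ha]
        intro hd
        have := Nat.le_of_dvd (by norm_num) hd
        have : 2 ^ 3 ≤ 2 ^ m := Nat.pow_le_pow_right (by norm_num) hm
        omega
      rcases hcpow k with hk | hk
      · rw [hk, mul_one] at hik
        have h1 : a ^ (2 : ℤ) = 1 := hint _ (Subgroup.zpow_mem _ (Subgroup.mem_zpowers a) 2)
          (hik ▸ Subgroup.zpow_mem _ (Subgroup.mem_zpowers y) i)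
        apply hord4
        have hd : (orderOf a : ℤ) ∣ 4 := (orderOf_dvd_iff_zpow_eq_one.2 h1).trans ⟨2, by norm_num⟩
        exact_mod_cast hd
      · rw [hk, hcαt'] at hik
        have h1 : a ^ (2 : ℤ) * α⁻¹ = y ^ i * t := by
          rw [hik, hαt.eq]
          group
        have h2 : a ^ (2 : ℤ) * α⁻¹ = 1 := hint _
          (Subgroup.mul_mem _ (Subgroup.zpow_mem _ (Subgroup.mem_zpowers a) 2) (Subgroup.inv_mem _ hαmem))
          (h1 ▸ Subgroup.mul_mem _ (Subgroup.zpow_mem _ (Subgroup.mem_zpowers y) i) htZy)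
        rw [mul_inv_eq_one] at h2
        apply hord4
        have h4 : a ^ (4 : ℤ) = 1 := by rw [show (4 : ℤ) = 2 * 2 by norm_num, zpow_mul, h2, zpow_two, hαα]
        have hd : (orderOf a : ℤ) ∣ 4 := orderOf_dvd_iff_zpow_eq_one.2 h4
        exact_mod_cast hd
    · -- `⟨y⟩ ∩ ⟨a²⟩ = 1`
      intro w hw₀ hw₁
      obtain ⟨i, hi⟩ := hzp u₀ w hw₀
      obtain ⟨j, hj⟩ := hzp u₁ w hw₁
      change (w : K ≃ₐ[ℚ] K) = y ^ i at hi
      change (w : K ≃ₐ[ℚ] K) = (a ^ (2 : ℤ)) ^ j at hj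
      apply Subtype.ext
      exact hint _ (hj ▸ by rw [← zpow_mul]; exact Subgroup.zpow_mem _ (Subgroup.mem_zpowers a) _)
        (hi ▸ Subgroup.zpow_mem _ (Subgroup.mem_zpowers y) i)
    · -- `x y x⁻¹ ∉ ⟨a²⟩`: its square `x t x⁻¹` would be an involution of `⟨a⟩`, i.e. `α`
      intro h
      obtain ⟨j, hj⟩ := hzp u₁ (θ u₀) h
      rw [hθu₀] at hj
      change x * y * x⁻¹ = (a ^ (2 : ℤ)) ^ j at hj
      have hsq : x * t * x⁻¹ = a ^ (4 * j) := by
        rw [← hxysq, hj, ← zpow_mul, ← zpow_mul]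
        congr 1
        ring
      have hsq1 : a ^ (2 * (4 * j)) = 1 := by
        rw [show (2 : ℤ) * (4 * j) = (4 * j) * 2 by ring, zpow_mul, ← hsq, zpow_two,
          show x * t * x⁻¹ * (x * t * x⁻¹) = x * (t * t) * x⁻¹ by group, htt]
        group
      rcases hZa2 (4 * j) hsq1 with h' | h'
      · exact ht1 (by
          rw [h'] at hsq
          have := congrArg (fun w => x⁻¹ * w * x) hsq
          simpa [mul_assoc] using this)
      · exact hxt (hsq.trans h')
    · -- `4 · ord(a²) = 2^(m+1) < 2^m · 4 ≤ |A|`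
      have : orderOf u₁ ≤ 2 ^ (m - 1) := by
        refine orderOf_le_of_pow_eq_one (by positivity) (Subtype.ext ?_)
        show (a ^ (2 : ℤ)) ^ (2 ^ (m - 1)) = 1
        rw [← zpow_natCast, ← zpow_mul, show (2 : ℤ) * ((2 ^ (m - 1) : ℕ) : ℤ) = 2 ^ m by push_cast; rw [h2m], ha2m]
      have h2 : 4 * 2 ^ (m - 1) < 2 ^ m * 4 := by
        rw [show 2 ^ m = 2 * 2 ^ (m - 1) by rw [← pow_succ', Nat.sub_add_cancel (by omega)]]
        have : 0 < 2 ^ (m - 1) := by positivity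
        omega
      omega

/-- **GOOD contrapositive**: in a Galois CM field all of whose primitive CM types are nondegenerate, there are no commuting `a`
(order `2^m ≥ 8`) and `y` (`y⁴ = 1 ≠ y²`) with `⟨a⟩ ∩ ⟨y⟩ = 1`, `⟨a, y⟩` of index `2` containing complex conjugation `c`, unless
`c = y²`. [cite: Shimura1998, §8.2 Prop. 26] -/
theorem complexConj_eq_sq_of_cyclic_times_four_index_two
    (hgood : ∀ (Φ : CMType K) (φ : K →+* ℂ), IsPrimitive (ℂ ≃+* ℂ) Φ.1 φ → IsNondegenerate Φ)
    (a y : K ≃ₐ[ℚ] K) (hay : a * y = y * a) {m : ℕ} (hm : 3 ≤ m) (ha : orderOf a = 2 ^ m) (hy4 : y ^ 4 = 1)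
    (hy2 : y * y ≠ 1) (hint : ∀ g : K ≃ₐ[ℚ] K, g ∈ Subgroup.zpowers a → g ∈ Subgroup.zpowers y → g = 1)
    (hidx : (Subgroup.closure ({a, y} : Set (K ≃ₐ[ℚ] K))).index = 2)
    (hcA : (IsCMField.complexConj K).restrictScalars ℚ ∈ Subgroup.closure ({a, y} : Set (K ≃ₐ[ℚ] K))) :
    (IsCMField.complexConj K).restrictScalars ℚ = y * y := by
  by_contra hct
  obtain ⟨Φ, φ, X, ι, ϑ, H1, H2, -⟩ :=
    exists_simple_degenerate_of_cyclic_times_four_index_two a y hay hm ha hy4 hy2 hint hidx hcA hct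
  exact H2 (hgood Φ φ H1)

end Summit.HodgeConjecture.CorCM.GaloisModels
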